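import Summits.QuantumFields.BalabanUV.T4Continuum.Spine.NE1p.DressedRoot

/-!
# T⁴ programme, spine estimate NE1′ (node O3b/H2) — leaf F-8 «attainment» of END-F DECIDED ONCE from the booking convention

Cell `pub-balaban`, sub-cell `t4`, NE1′ formalisation swarm `b2b-balaban-t4-ne1p-formalise-*`, seat LEAF PROVER 06
(own-initiative supplier item NE1p-F8-ATTAIN, journal INTENT CLAIMS.log l.8509; not a crew row — the owner t4-ne1p-p1 may
refuse or re-cut it); tree target `Summits/QuantumFields/BalabanUV/T4Continuum/Spine/NE1p/`; ADDITIVE — imports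
`Spine/NE1p/DressedRoot` ONLY, modifies nothing.

WHAT.  END-F `DressedRoot.transportLeaf_of_centredExponent` (and its assembled forms END-F′/END-F″ of the crew) displays
the binder `hlin` — leaf F-8 of the owner skeleton `t4/skeletons/NE1p-t4-ne1p-p1.md` §2 («attainment: booked size ≤ realised
increment over an admissible pair of defect ≤ δ (+ε); supplier = booking convention (instantiation sets `lin := sup …`);
STRUCTURAL; ROUTINE»):
  `∀ b k′ k, j_b ≤ k′ → k′ ≤ k → k ≤ K → RanBelow Gate k → ∀ ε > 0, ∃ U₀ ∈ 𝒦 b k′ k, ∃ U₁,`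
  `  RelGauge (rel b k′ k) latMove latN U₀ U₁ (defect b k′ k) ∧ T.lin b k′ k ≤ ‖Fn b k′ k U₁ − Fn b k′ k U₀‖ + ε`.
This file discharges it ONCE, generically, from exactly what the booking convention provides: (i) the admissible pairs of
defect `defect b k′ k` are NON-EMPTY under the history, and (ii) the booked size `T.lin b k′ k` is AT MOST the supremum of the
realised increments over those pairs (equality = the convention `lin := sSup …`; any smaller booking also qualifies).  No
boundedness of the increment set is needed (`Real.sSup` of an unbounded set is `0`, and an unbounded set exceeds any booked
number anyway).  An ε-free variant (an attaining pair exists) is recorded too.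

* §1 `exists_le_add_of_le_sSup` — the one real-analysis fact: `s ≠ ∅`, `a ≤ sSup s`, `ε > 0` ⟹ `∃ x ∈ s, a ≤ x + ε`.
* §2 `hlin_of_lin_le_sSup` (abstract configurations `𝒰`, chart `move`, window norm `N`, any `Gate`), `hlin_of_attained`.
* §3 `hlin_budgetGate_of_lin_le_sSup` — the lattice ∕ dressed-gate instance whose conclusion is VERBATIM the binder `hlin`
  of END-F (`𝒰 = Fld d R`, `latMove`, `latN`, `Gate := budgetGate T s m S (4c_δ/r) (ψ·α)`), and `hlin_budgetGate_of_attained`.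
* §4 `transportLeaf_of_centredExponent_linSup` — END-F BY NAME with `hlin` REPLACED by the convention's `hne`/`hsup` (the
  kernel's check that §3 plugs in literally); conclusion = END-F's = the field `htr` of `BookingLeaves`.

* §5 (v1.1, leaf-08, row S8.1) hypothesis (i) `hne` discharged on the lattice chart: ONE data `def` `nullDir` (the motionless
  direction), `admissiblePair_of_refl`, `hlin_budgetGate_of_lin_le_sSup_refl`, the sharpness round trip `lin_le_sSup_of_attain`.

HONEST FRAMING.  [folklore] bookkeeping about suprema of real numbers; 0 sorry; ONE data `def` (`nullDir`, §5 — v1.2 doc-fix of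
this sentence, X76 INFO-1; §§1–4 declare no `def`), no `def … : Prop`; nothing of
Bałaban's densities is asserted, no wall leaf (L-A/F-3, F-1, L-R, F-6) is touched; every headline reads «F-8 ⇐ the booking
convention», never «NE1′ proved».  NE1′ is NOT printed, NOT proved; 0 binders instantiated on Bałaban's densities; spine
PROVED 0∕9; rung (B)+1 on ONE finite T⁴ — NOT infinite volume, NOT a mass gap, NOT the Clay problem.  HONEST DEPENDENCY:
continuum YM on T⁴ ⇐ BetaPertH ∧ nine spine estimates (0/9 proved); BetaPertH ⇐ (D1) ∧ (D4) ∧ CAP+tail; G-an2-4 gates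
asym, D1 and NE2/3/4.
-/

noncomputable section

namespace Summit.QuantumFields.BalabanUV.T4Continuum.NE1p.DressedAttainment

open Set
open Literature.MathematicalPhysics.QuantumFieldTheory.Balaban1983to89
open Literature.MathematicalPhysics.QuantumFieldTheory.Balaban1983to89.T4TrajectoryComparison
open Summit.QuantumFields.BalabanUV.T4Continuum.T4TrajectoryDensityDressed
open T4BirthChartTransport (RelGauge)
open T4BlockTransport (Fld NDir latMove latN)

/-! ## §1 The real-analysis fact -/

/-- **A number below a supremum is ε-attained**: for a non-empty `s ⊆ ℝ`, `a ≤ sSup s` and `ε > 0` give `x ∈ s` with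
`a ≤ x + ε`.  If `s` is bounded above this is `exists_lt_of_lt_csSup`; if not, `s` exceeds `a` itself
(`not_bddAbove_iff`) — so NO boundedness hypothesis is needed. [folklore] -/
theorem exists_le_add_of_le_sSup {s : Set ℝ} (hne : s.Nonempty) {a ε : ℝ} (ha : a ≤ sSup s) (hε : 0 < ε) :
    ∃ x ∈ s, a ≤ x + ε := by
  by_cases hb : BddAbove s
  · obtain ⟨x, hx, hlt⟩ := exists_lt_of_lt_csSup hne (show sSup s - ε < sSup s by linarith)
    exact ⟨x, hx, by linarith⟩
  · obtain ⟨x, hx, hlt⟩ := not_bddAbove_iff.mp hb a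
    exact ⟨x, hx, by linarith⟩

/-! ## §2 Attainment from the booking convention — abstract configurations, any gate -/

section Abstract

variable {B : T4TermFormat.Booking} {T : Trajectory B} {𝒰 Dir F : Type*} [NormedAddCommGroup F]

/-- **F-8 FROM THE BOOKING CONVENTION** [bookkeeping]: if, for every generation `(b, k′)` and step `k` under the history,
(i) SOME admissible pair exists — a base point `U₀ ∈ 𝒦 b k′ k` and a partner `U₁` in `RelGauge (rel b k′ k)` of defect
`defect b k′ k` — and (ii) the booked size `T.lin b k′ k` is at most the supremum of the realised increments
`‖Fn b k′ k U₁ − Fn b k′ k U₀‖` over such pairs (the convention `lin := sSup …` gives equality), THEN the attainment binder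
`hlin` of the transport capstones holds: every `ε > 0` is met by an admissible pair.  Any `Gate`. [folklore] -/
theorem hlin_of_lin_le_sSup {Gate : ℕ → Prop} {Fn : B.Birth → ℕ → ℕ → 𝒰 → F}
    {rel : B.Birth → ℕ → ℕ → 𝒰 → 𝒰 → Prop} {move : 𝒰 → Dir → ℂ → 𝒰} {N : Dir → ℝ}
    {𝒦 : B.Birth → ℕ → ℕ → Set 𝒰} {defect : B.Birth → ℕ → ℕ → ℝ}
    (hne : ∀ (b : B.Birth) (k' k : ℕ), B.birthScale b ≤ k' → k' ≤ k → k ≤ B.K → RanBelow Gate k →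
      ∃ U₀ ∈ 𝒦 b k' k, ∃ U₁ : 𝒰, RelGauge (rel b k' k) move N U₀ U₁ (defect b k' k))
    (hsup : ∀ (b : B.Birth) (k' k : ℕ), B.birthScale b ≤ k' → k' ≤ k → k ≤ B.K → RanBelow Gate k →
      T.lin b k' k ≤ sSup {x : ℝ | ∃ U₀ ∈ 𝒦 b k' k, ∃ U₁ : 𝒰,
        RelGauge (rel b k' k) move N U₀ U₁ (defect b k' k) ∧ x = ‖Fn b k' k U₁ - Fn b k' k U₀‖}) :
    ∀ (b : B.Birth) (k' k : ℕ), B.birthScale b ≤ k' → k' ≤ k → k ≤ B.K → RanBelow Gate k → ∀ ε > 0,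
      ∃ U₀ ∈ 𝒦 b k' k, ∃ U₁ : 𝒰, RelGauge (rel b k' k) move N U₀ U₁ (defect b k' k) ∧
        T.lin b k' k ≤ ‖Fn b k' k U₁ - Fn b k' k U₀‖ + ε := by
  intro b k' k hb hk' hk hran ε hε
  obtain ⟨V₀, hV₀, V₁, hV⟩ := hne b k' k hb hk' hk hran
  have hsne : ({x : ℝ | ∃ U₀ ∈ 𝒦 b k' k, ∃ U₁ : 𝒰,
      RelGauge (rel b k' k) move N U₀ U₁ (defect b k' k) ∧ x = ‖Fn b k' k U₁ - Fn b k' k U₀‖}).Nonempty :=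
    ⟨_, V₀, hV₀, V₁, hV, rfl⟩
  obtain ⟨x, ⟨U₀, hU₀, U₁, hrel, rfl⟩, hle⟩ := exists_le_add_of_le_sSup hsne (hsup b k' k hb hk' hk hran) hε
  exact ⟨U₀, hU₀, U₁, hrel, hle⟩

/-- **F-8, ε-FREE VARIANT** [bookkeeping]: if the booked size is realised (or exceeded) by ONE admissible pair of defect
`defect b k′ k` under the history, the attainment binder holds for every `ε > 0` with that pair. [folklore] -/
theorem hlin_of_attained {Gate : ℕ → Prop} {Fn : B.Birth → ℕ → ℕ → 𝒰 → F}
    {rel : B.Birth → ℕ → ℕ → 𝒰 → 𝒰 → Prop} {move : 𝒰 → Dir → ℂ → 𝒰} {N : Dir → ℝ}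
    {𝒦 : B.Birth → ℕ → ℕ → Set 𝒰} {defect : B.Birth → ℕ → ℕ → ℝ}
    (hatt : ∀ (b : B.Birth) (k' k : ℕ), B.birthScale b ≤ k' → k' ≤ k → k ≤ B.K → RanBelow Gate k →
      ∃ U₀ ∈ 𝒦 b k' k, ∃ U₁ : 𝒰, RelGauge (rel b k' k) move N U₀ U₁ (defect b k' k) ∧
        T.lin b k' k ≤ ‖Fn b k' k U₁ - Fn b k' k U₀‖) :
    ∀ (b : B.Birth) (k' k : ℕ), B.birthScale b ≤ k' → k' ≤ k → k ≤ B.K → RanBelow Gate k → ∀ ε > 0,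
      ∃ U₀ ∈ 𝒦 b k' k, ∃ U₁ : 𝒰, RelGauge (rel b k' k) move N U₀ U₁ (defect b k' k) ∧
        T.lin b k' k ≤ ‖Fn b k' k U₁ - Fn b k' k U₀‖ + ε := by
  intro b k' k hb hk' hk hran ε hε
  obtain ⟨U₀, hU₀, U₁, hrel, hle⟩ := hatt b k' k hb hk' hk hran
  exact ⟨U₀, hU₀, U₁, hrel, by linarith⟩

/-- The convention's supremum is never negative: the increments are norms, and `Real.sSup` of an empty or unbounded set is
`0` — so a generation booked with size `0` (e.g. not yet born, or dead) satisfies hypothesis (ii) of `hlin_of_lin_le_sSup`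
automatically. [folklore] -/
theorem sSup_increments_nonneg {Fn : 𝒰 → F} {rel : 𝒰 → 𝒰 → Prop} {move : 𝒰 → Dir → ℂ → 𝒰} {N : Dir → ℝ}
    {𝒦 : Set 𝒰} {δ : ℝ} :
    0 ≤ sSup {x : ℝ | ∃ U₀ ∈ 𝒦, ∃ U₁ : 𝒰, RelGauge rel move N U₀ U₁ δ ∧ x = ‖Fn U₁ - Fn U₀‖} := by
  refine Real.sSup_nonneg ?_
  rintro _ ⟨_, -, _, -, rfl⟩
  exact norm_nonneg _

end Abstract

/-! ## §3 The lattice ∕ dressed-gate instance: VERBATIM the binder `hlin` of END-F -/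

section Lattice

variable {B : T4TermFormat.Booking} {T : Trajectory B}
variable {R : Type*} [NormedRing R] [NormedAlgebra ℂ R] {d : ℕ} {F : Type*} [NormedAddCommGroup F]

/-- **F-8 FOR END-F, VERBATIM** [bookkeeping]: on the lattice chart (`Fld d R`, `latMove`, `latN`) with the dressed budget as
the gate, `Gate := budgetGate T s m S (4c_δ/r) (ψ·α)`, the booking convention ((i) admissible pairs exist, (ii) `lin ≤ sSup`
of the realised increments) gives EXACTLY the binder `hlin` of `DressedRoot.transportLeaf_of_centredExponent`. [folklore] -/
theorem hlin_budgetGate_of_lin_le_sSup {Fn : B.Birth → ℕ → ℕ → Fld d R → F}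
    {rel : B.Birth → ℕ → ℕ → Fld d R → Fld d R → Prop} {𝒦 : B.Birth → ℕ → ℕ → Set (Fld d R)}
    {defect : B.Birth → ℕ → ℕ → ℝ} {cδ ψ r m : ℝ} {s : B.Birth → ℕ → ℝ} {α : ℕ → ℝ}
    {S : ℕ → B.Birth → Finset B.Birth}
    (hne : ∀ (b : B.Birth) (k' k : ℕ), B.birthScale b ≤ k' → k' ≤ k → k ≤ B.K →
      RanBelow (budgetGate T s m S (4 * cδ / r) (fun i => ψ * α i)) k →
      ∃ U₀ ∈ 𝒦 b k' k, ∃ U₁ : Fld d R, RelGauge (rel b k' k) latMove latN U₀ U₁ (defect b k' k))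
    (hsup : ∀ (b : B.Birth) (k' k : ℕ), B.birthScale b ≤ k' → k' ≤ k → k ≤ B.K →
      RanBelow (budgetGate T s m S (4 * cδ / r) (fun i => ψ * α i)) k →
      T.lin b k' k ≤ sSup {x : ℝ | ∃ U₀ ∈ 𝒦 b k' k, ∃ U₁ : Fld d R,
        RelGauge (rel b k' k) latMove latN U₀ U₁ (defect b k' k) ∧ x = ‖Fn b k' k U₁ - Fn b k' k U₀‖}) :
    ∀ (b : B.Birth) (k' k : ℕ), B.birthScale b ≤ k' → k' ≤ k → k ≤ B.K →
      RanBelow (budgetGate T s m S (4 * cδ / r) (fun i => ψ * α i)) k → ∀ ε > 0,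
      ∃ U₀ ∈ 𝒦 b k' k, ∃ U₁ : Fld d R, RelGauge (rel b k' k) latMove latN U₀ U₁ (defect b k' k) ∧
        T.lin b k' k ≤ ‖Fn b k' k U₁ - Fn b k' k U₀‖ + ε :=
  hlin_of_lin_le_sSup (T := T) hne hsup

/-- **F-8 FOR END-F, ε-FREE VARIANT** [bookkeeping]: an attaining admissible pair under the dressed history gives the
binder `hlin` of `DressedRoot.transportLeaf_of_centredExponent` verbatim. [folklore] -/
theorem hlin_budgetGate_of_attained {Fn : B.Birth → ℕ → ℕ → Fld d R → F}
    {rel : B.Birth → ℕ → ℕ → Fld d R → Fld d R → Prop} {𝒦 : B.Birth → ℕ → ℕ → Set (Fld d R)}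
    {defect : B.Birth → ℕ → ℕ → ℝ} {cδ ψ r m : ℝ} {s : B.Birth → ℕ → ℝ} {α : ℕ → ℝ}
    {S : ℕ → B.Birth → Finset B.Birth}
    (hatt : ∀ (b : B.Birth) (k' k : ℕ), B.birthScale b ≤ k' → k' ≤ k → k ≤ B.K →
      RanBelow (budgetGate T s m S (4 * cδ / r) (fun i => ψ * α i)) k →
      ∃ U₀ ∈ 𝒦 b k' k, ∃ U₁ : Fld d R, RelGauge (rel b k' k) latMove latN U₀ U₁ (defect b k' k) ∧
        T.lin b k' k ≤ ‖Fn b k' k U₁ - Fn b k' k U₀‖) :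
    ∀ (b : B.Birth) (k' k : ℕ), B.birthScale b ≤ k' → k' ≤ k → k ≤ B.K →
      RanBelow (budgetGate T s m S (4 * cδ / r) (fun i => ψ * α i)) k → ∀ ε > 0,
      ∃ U₀ ∈ 𝒦 b k' k, ∃ U₁ : Fld d R, RelGauge (rel b k' k) latMove latN U₀ U₁ (defect b k' k) ∧
        T.lin b k' k ≤ ‖Fn b k' k U₁ - Fn b k' k U₀‖ + ε :=
  hlin_of_attained (T := T) hatt

end Lattice

/-! ## §4 END-F with F-8 discharged: the transport leaf from the booking convention (kernel check of literal compatibility) -/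

section EndF

open MeasureTheory Set Metric
open T4BirthChartTransport (GaugeInvariant BirthSlice RelGauge)
open T4TrajectoryDensity

variable {B : T4TermFormat.Booking} {T : Trajectory B}
variable {R : Type*} [NormedRing R] [NormedAlgebra ℂ R] [MeasurableSpace R] {d : ℕ}
  {F : Type*} [NormedAddCommGroup F] [NormedSpace ℂ F] [CompleteSpace F]

/-- **END-F WITH LEAF F-8 DISCHARGED BY THE BOOKING CONVENTION** [bookkeeping]: `DressedRoot.transportLeaf_of_centredExponent`
with its attainment binder `hlin` REPLACED by the convention's two facts — `hne` (admissible pairs of defect `defect b k′ k`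
exist under the dressed history) and `hsup` (`T.lin b k′ k ≤ sSup` of the realised increments over them); every other
displayed binder ((w1) `hsl`, H2 `hFn`/`h𝒢`/`hDμ`, (w2-act) `hB`/`hE`, `hP`, (w3)⁺ `hN1`/`hN2`/`hdiam`/`hθ`, (w4) `hdom`,
(I4′) `hdefw`/`hrate`, `hinv`, positivity) is END-F's, unchanged, and the conclusion is END-F's: the field `htr` of
`BookingLeaves`.  This is the kernel's check that §3 supplies `hlin` LITERALLY. «L-T ⇐ F-1…F-7, F-9 + the booking
convention»; nothing of Bałaban's densities asserted. [folklore] -/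
theorem transportLeaf_of_centredExponent_linSup {Fn : B.Birth → ℕ → ℕ → Fld d R → F}
    {rel : B.Birth → ℕ → ℕ → Fld d R → Fld d R → Prop} {𝒦 : B.Birth → ℕ → ℕ → Set (Fld d R)}
    {ref : B.Birth → ℕ → Fld d R → Fld d R} {base : B.Birth → ℕ → Fld d R → ℝ}
    {𝒜 𝒬 : B.Birth → ℕ → Fld d R → Fld d R → ℂ} {q : B.Birth → ℕ → Fld d R → ℂ}
    {μ : B.Birth → ℕ → Measure (Fld d R)} {z₀ : B.Birth → ℕ → Fld d R} {D : B.Birth → ℕ → Set (Fld d R)}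
    {defect : B.Birth → ℕ → ℕ → ℝ} {cδ ψ w r m : ℝ} {s θ : B.Birth → ℕ → ℝ} {α : ℕ → ℝ}
    {ϱ : B.Birth → ℕ → ℕ → ℝ} {S : ℕ → B.Birth → Finset B.Birth}
    (hα : ∀ i, 0 ≤ α i) (hr : 0 < r) (hw : 0 < w)
    (hsl : ∀ (b : B.Birth) (k' : ℕ), B.birthScale b ≤ k' → k' ≤ B.K →
      RanBelow (budgetGate T s m S (4 * cδ / r) (fun i => ψ * α i)) k' →
      BirthSlice (Fn b k' k') latMove latN (𝒦 b k' k') w r (T.gen b k'))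
    (hFn : ∀ (b : B.Birth) (k' k : ℕ), B.birthScale b ≤ k' → k' ≤ k → k + 1 ≤ B.K →
      RanBelow (budgetGate T s m S (4 * cδ / r) (fun i => ψ * α i)) (k + 1) →
      ∀ U, Fn b k' (k + 1) U =
        wOp (expWeight (base b k) (𝒜 b k + 𝒬 b k)) (μ b k) (z₀ b k) U (fun z => Fn b k' k (U + z)))
    (h𝒢 : ∀ (b : B.Birth) (k' k : ℕ), B.birthScale b ≤ k' → k' ≤ k → k + 1 ≤ B.K →
      RanBelow (budgetGate T s m S (4 * cδ / r) (fun i => ψ * α i)) (k + 1) →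
      ∀ U, (fun z => Fn b k' k (U + z)) ∈ BddClass F (μ b k))
    (hD : ∀ b k, (D b k).Nonempty) (hϱ : ∀ b k' k, 0 < ϱ b k' k)
    (hB : ∀ (b : B.Birth) (k' k : ℕ), B.birthScale b ≤ k' → k' ≤ k → k + 1 ≤ B.K →
      RanBelow (budgetGate T s m S (4 * cδ / r) (fun i => ψ * α i)) (k + 1) →
      RealBaseAt (ref b k) (base b k) (𝒜 b k) (μ b k) (𝒦 b k' (k + 1)))
    (hE : ∀ (b : B.Birth) (k' k : ℕ), B.birthScale b ≤ k' → k' ≤ k → k + 1 ≤ B.K →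
      RanBelow (budgetGate T s m S (4 * cδ / r) (fun i => ψ * α i)) (k + 1) →
      ExponentSliceAt (ref b k) (𝒜 b k) (μ b k) latMove latN (𝒦 b k' (k + 1)) w (ϱ b k' k) (s b k))
    (hP : ∀ (b : B.Birth) (k' k : ℕ), B.birthScale b ≤ k' → k' ≤ k → k + 1 ≤ B.K →
      RanBelow (budgetGate T s m S (4 * cδ / r) (fun i => ψ * α i)) (k + 1) →
      PertSlice (fun U z => 𝒬 b k U z - q b k U) (μ b k) latMove latN (𝒦 b k' (k + 1)) w (ϱ b k' k)
        (m * ∑ f ∈ S k b, T.envVar (4 * cδ / r) (fun i => ψ * α i) f k))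
    (hDμ : ∀ b k, ∀ᵐ z ∂μ b k, z ∈ D b k)
    (hN1 : ∀ (b : B.Birth) (k' k : ℕ), B.birthScale b ≤ k' → k' ≤ k → k + 1 ≤ B.K →
      ∀ z ∈ D b k, ∀ U ∈ 𝒦 b k' (k + 1), U + z ∈ 𝒦 b k' k)
    (hN2 : ∀ (b : B.Birth) (k' k : ℕ), B.birthScale b ≤ k' → k' ≤ k → k + 1 ≤ B.K →
      ∀ U₀ ∈ 𝒦 b k' (k + 1), ∀ p : NDir d R, latN p ≤ w → ∀ z' ∈ D b k, latMove U₀ p 1 + z' ∈ 𝒦 b k' k)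
    (hdiam : ∀ b k, ∀ z ∈ D b k, ∀ z' ∈ D b k, ∀ x ν, ‖z x ν - z' x ν‖ ≤ θ b k)
    (hθ : ∀ b k, 0 < θ b k ∧ θ b k ≤ w)
    (hdom : ∀ (b : B.Birth) (k' k : ℕ), B.birthScale b ≤ k' → k' ≤ k → k + 1 ≤ B.K →
      Real.exp 3 * (1 + 4 * θ b k / ϱ b k' k) ≤ α k)
    (hinv : ∀ b k' k, GaugeInvariant (rel b k' k) (Fn b k' k))
    (hdefw : ∀ b k' k, defect b k' k ≤ w)
    (hrate : ∀ (b : B.Birth) (k' k : ℕ), B.birthScale b ≤ k' → k' ≤ k → k ≤ B.K →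
      defect b k' k ≤ cδ * ψ ^ (k - k'))
    (hne : ∀ (b : B.Birth) (k' k : ℕ), B.birthScale b ≤ k' → k' ≤ k → k ≤ B.K →
      RanBelow (budgetGate T s m S (4 * cδ / r) (fun i => ψ * α i)) k →
      ∃ U₀ ∈ 𝒦 b k' k, ∃ U₁ : Fld d R, RelGauge (rel b k' k) latMove latN U₀ U₁ (defect b k' k))
    (hsup : ∀ (b : B.Birth) (k' k : ℕ), B.birthScale b ≤ k' → k' ≤ k → k ≤ B.K →
      RanBelow (budgetGate T s m S (4 * cδ / r) (fun i => ψ * α i)) k →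
      T.lin b k' k ≤ sSup {x : ℝ | ∃ U₀ ∈ 𝒦 b k' k, ∃ U₁ : Fld d R,
        RelGauge (rel b k' k) latMove latN U₀ U₁ (defect b k' k) ∧ x = ‖Fn b k' k U₁ - Fn b k' k U₀‖}) :
    T.TransportsFromVar (4 * cδ / r) (fun i => ψ * α i) (budgetGate T s m S (4 * cδ / r) (fun i => ψ * α i)) :=
  DressedRoot.transportLeaf_of_centredExponent hα hr hw hsl hFn h𝒢 hD hϱ hB hE hP hDμ hN1 hN2 hdiam hθ hdom hinv hdefw
    hrate (hlin_budgetGate_of_lin_le_sSup (T := T) hne hsup)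

end EndF

/-! ## §5 (v1.1, leaf-08 — typer row S8.1, leaf-06's invitation CLAIMS.log l.8745/l.8756) Hypothesis (i) discharged on the
lattice chart, and the converse of (ii) under boundedness

Two additions to §2–§4, nothing above edited: (a) on `T4BlockTransport`'s lattice chart the admissible pairs of hypothesis (i)
exist TRIVIALLY — the zero bond field with DECLARED bound `δ` is a direction of `latN = δ` that moves nothing, so a reflexive gauge
relation, a positive defect and a non-empty window give the pair `(U₀, U₀)` (`T4BirthChartTransport.relGauge_of_move` by name);
hence END-F's `hlin` from hypothesis (ii) ALONE plus «windows non-empty, defects positive, `rel` reflexive»; (b) the convention is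
SHARP: when the realised increments are bounded, the attainment binder conversely forces `lin ≤ sSup …`. [folklore] -/

section Supplement

/-- **CONVERSE OF `exists_le_add_of_le_sSup` UNDER BOUNDEDNESS** [folklore]: if for every `ε > 0` some `x ∈ s` has `a ≤ x + ε`
and `s` is bounded above, then `a ≤ sSup s`. -/
theorem le_sSup_of_forall_exists_le_add {s : Set ℝ} {a : ℝ} (hb : BddAbove s)
    (h : ∀ ε > 0, ∃ x ∈ s, a ≤ x + ε) : a ≤ sSup s := by
  refine le_of_forall_pos_le_add fun ε hε => ?_
  obtain ⟨x, hx, hax⟩ := h ε hε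
  exact hax.trans (add_le_add (le_csSup hb hx) le_rfl)

variable {R : Type*} [NormedRing R] {d : ℕ}

/-- **THE NULL DIRECTION WITH DECLARED BOUND `δ`** [data]: the zero bond field, declared with sup bound `δ ≥ 0` (the window-norm
slot `latN` of `T4BlockTransport.NDir` is the DECLARED bound, so this direction has `latN = δ` while moving nothing). -/
def nullDir (δ : ℝ) (hδ : 0 ≤ δ) : NDir d R :=
  ⟨(0, δ), fun x ν => by simpa using hδ⟩

/-- The null direction's declared bound. [folklore] -/
@[simp] theorem latN_nullDir (δ : ℝ) (hδ : 0 ≤ δ) : latN (nullDir (d := d) (R := R) δ hδ) = δ := rfl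

variable [NormedAlgebra ℂ R]

/-- The chart along the null direction does not move. [folklore] -/
@[simp] theorem latMove_nullDir (U : Fld d R) (δ : ℝ) (hδ : 0 ≤ δ) (t : ℂ) : latMove U (nullDir δ hδ) t = U := by
  funext x ν
  simp [latMove, nullDir]

/-- **ADMISSIBLE PAIRS EXIST TRIVIALLY ON THE LATTICE CHART** [folklore]: for a reflexive relation `rel`, a positive defect `δ`
and a base `U₀ ∈ 𝒦`, the pair `(U₀, U₀)` is admissible — `U₀` is in relative gauge of defect `δ` with itself along the null
direction (`T4BirthChartTransport.relGauge_of_move` by name). -/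
theorem admissiblePair_of_refl {rel : Fld d R → Fld d R → Prop} {𝒦 : Set (Fld d R)} {δ : ℝ}
    (hrefl : ∀ U, rel U U) (hδ : 0 < δ) {U₀ : Fld d R} (hU₀ : U₀ ∈ 𝒦) :
    ∃ U₀ ∈ 𝒦, ∃ U₁ : Fld d R, RelGauge rel latMove latN U₀ U₁ δ := by
  refine ⟨U₀, hU₀, latMove U₀ (nullDir δ hδ.le) 1, ?_⟩
  simpa using T4BirthChartTransport.relGauge_of_move (move := latMove) (N := latN) hrefl (U₀ := U₀)
    (d := nullDir δ hδ.le) (by simpa using hδ)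

variable {B : T4TermFormat.Booking} {T : Trajectory B} {F : Type*} [NormedAddCommGroup F]

/-- **HYPOTHESIS (i) OF §2/§3 DISCHARGED** [folklore]: non-empty windows, positive defects and a reflexive gauge relation give
the admissible pairs, for every generation, step and history (any `Gate`). -/
theorem hne_of_refl {Gate : ℕ → Prop} {rel : B.Birth → ℕ → ℕ → Fld d R → Fld d R → Prop}
    {𝒦 : B.Birth → ℕ → ℕ → Set (Fld d R)} {defect : B.Birth → ℕ → ℕ → ℝ}
    (hrefl : ∀ b k' k U, rel b k' k U U) (hdef : ∀ b k' k, 0 < defect b k' k) (h𝒦 : ∀ b k' k, (𝒦 b k' k).Nonempty) :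
    ∀ (b : B.Birth) (k' k : ℕ), B.birthScale b ≤ k' → k' ≤ k → k ≤ B.K → RanBelow Gate k →
      ∃ U₀ ∈ 𝒦 b k' k, ∃ U₁ : Fld d R, RelGauge (rel b k' k) latMove latN U₀ U₁ (defect b k' k) := by
  intro b k' k _ _ _ _
  obtain ⟨U₀, hU₀⟩ := h𝒦 b k' k
  exact admissiblePair_of_refl (hrefl b k' k) (hdef b k' k) hU₀

/-- **F-8 FOR END-F FROM HYPOTHESIS (ii) ALONE** [bookkeeping]: with non-empty windows, positive defects and a reflexive gauge
relation, the booking convention `lin ≤ sSup` of the realised increments gives the binder `hlin` of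
`DressedRoot.transportLeaf_of_centredExponent` verbatim (§3's `hlin_budgetGate_of_lin_le_sSup` with (i) from `hne_of_refl`). [folklore] -/
theorem hlin_budgetGate_of_lin_le_sSup_refl {Fn : B.Birth → ℕ → ℕ → Fld d R → F}
    {rel : B.Birth → ℕ → ℕ → Fld d R → Fld d R → Prop} {𝒦 : B.Birth → ℕ → ℕ → Set (Fld d R)}
    {defect : B.Birth → ℕ → ℕ → ℝ} {cδ ψ r m : ℝ} {s : B.Birth → ℕ → ℝ} {α : ℕ → ℝ}
    {S : ℕ → B.Birth → Finset B.Birth}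
    (hrefl : ∀ b k' k U, rel b k' k U U) (hdef : ∀ b k' k, 0 < defect b k' k) (h𝒦 : ∀ b k' k, (𝒦 b k' k).Nonempty)
    (hsup : ∀ (b : B.Birth) (k' k : ℕ), B.birthScale b ≤ k' → k' ≤ k → k ≤ B.K →
      RanBelow (budgetGate T s m S (4 * cδ / r) (fun i => ψ * α i)) k →
      T.lin b k' k ≤ sSup {x : ℝ | ∃ U₀ ∈ 𝒦 b k' k, ∃ U₁ : Fld d R,
        RelGauge (rel b k' k) latMove latN U₀ U₁ (defect b k' k) ∧ x = ‖Fn b k' k U₁ - Fn b k' k U₀‖}) :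
    ∀ (b : B.Birth) (k' k : ℕ), B.birthScale b ≤ k' → k' ≤ k → k ≤ B.K →
      RanBelow (budgetGate T s m S (4 * cδ / r) (fun i => ψ * α i)) k → ∀ ε > 0,
      ∃ U₀ ∈ 𝒦 b k' k, ∃ U₁ : Fld d R, RelGauge (rel b k' k) latMove latN U₀ U₁ (defect b k' k) ∧
        T.lin b k' k ≤ ‖Fn b k' k U₁ - Fn b k' k U₀‖ + ε :=
  hlin_budgetGate_of_lin_le_sSup (T := T) (hne_of_refl hrefl hdef h𝒦) hsup

/-- **THE CONVENTION IS SHARP** [folklore]: if the realised increments of a generation at a step are bounded above and its booked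
size is `ε`-attained by admissible pairs for every `ε > 0` (the `hlin` clause), then `lin ≤ sSup` of the increments — hypothesis
(ii) is also NECESSARY under boundedness. -/
theorem lin_le_sSup_of_attain {Fn : Fld d R → F} {rel : Fld d R → Fld d R → Prop} {𝒦 : Set (Fld d R)} {δ lin : ℝ}
    (hb : BddAbove {x : ℝ | ∃ U₀ ∈ 𝒦, ∃ U₁ : Fld d R, RelGauge rel latMove latN U₀ U₁ δ ∧ x = ‖Fn U₁ - Fn U₀‖})
    (h : ∀ ε > 0, ∃ U₀ ∈ 𝒦, ∃ U₁ : Fld d R, RelGauge rel latMove latN U₀ U₁ δ ∧ lin ≤ ‖Fn U₁ - Fn U₀‖ + ε) :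
    lin ≤ sSup {x : ℝ | ∃ U₀ ∈ 𝒦, ∃ U₁ : Fld d R, RelGauge rel latMove latN U₀ U₁ δ ∧ x = ‖Fn U₁ - Fn U₀‖} :=
  le_sSup_of_forall_exists_le_add hb fun ε hε => by
    obtain ⟨U₀, hU₀, U₁, hU₁, hle⟩ := h ε hε
    exact ⟨_, ⟨U₀, hU₀, U₁, hU₁, rfl⟩, hle⟩

end Supplement

end Summit.QuantumFields.BalabanUV.T4Continuum.NE1p.DressedAttainment

end
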